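import Literature.Algebra.Module.FibreRankSemicontinuity
import Literature.Algebra.Module.ReprModuleTwoTermKernel
import Mathlib.LinearAlgebra.Dual.Lemmas
import Mathlib.RingTheory.TensorProduct.Basic
import HarnessLib

/-!
# Cohomology and base change in degree `0` for a two-term complex of finite projective modules
# (Mumford, *Abelian Varieties*, §5 Cor. 1–2; Görtz–Wedhorn I Cor. 7.31, II Thm. 23.139 (2); EGA III 7.7.5, 7.8.4)

Topic `Algebra/Module`; namespace `Literature.Algebra.Module`; a *proofs* file (theorems only; Mathlib +
★ `Algebra/Module/ReprModuleTwoTermKernel` + ★ `Algebra/Module/FibreRankSemicontinuity`). The **Grothendieck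
complex** of a flat coherent sheaf on a proper family over an affine base `Spec A` (Mumford, *Abelian
Varieties*, §5; Görtz–Wedhorn II, Cor. 23.135 / 23.137; in this tree ★ `Modules/GrothendieckComplexKernelRepr`
for a rank-one `L` on `P ×_K T`, and `Motives/SeesawGrauert*` for `𝒪(D)` on an integral total space) is a
complex `K⁰ →ᵈ K¹ → ⋯` of finite projective `A`-modules with `H⁰(X_B, 𝓕_B) ≅ ker(d ⊗_A B)` for every
`A`-algebra `B`. This file is the LINEAR ALGEBRA of §5 behind «semicontinuity» and «cohomology and base
change» in degree `0`, for an arbitrary `A`-linear `d : K⁰ → K¹` between finite projective modules, phrased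
with Mathlib's `PrimeSpectrum A` and residue fields `κ(𝔭) = 𝔭.asIdeal.ResidueField`:

* (§1 = the sibling ★ `Algebra/Module/FibreRankSemicontinuity`: upper semicontinuity of the fibre rank
  `𝔭 ↦ dim_{κ(𝔭)} (κ(𝔭) ⊗_A M)` of a finite module, Görtz–Wedhorn I Cor. 7.31, and «constant fibre rank over a
  noetherian domain ⇒ projective», Hartshorne II Ex. 5.8 (c).)
* §2 (two-term complexes) the kernel functor `B ↦ ker(d ⊗ B)` is `Hom_A(Q, −)` for the EXPLICIT finite module
  `Q = (K⁰)^∨ ⧸ im(d^∨)` (`exists_kerEquiv_quotient_dual` = ★ `exists_reprModule_of_perfect_two_term` with its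
  witness named), so `h⁰(𝔭) := dim_{κ(𝔭)} ker(d ⊗ κ(𝔭)) = dim_{κ(𝔭)} (κ(𝔭) ⊗_A Q)`
  (`finrank_ker_baseChange_eq_finrank_tensor`) and **`h⁰` is upper semicontinuous on `Spec A`**
  (`isClosed_setOf_le_finrank_ker_baseChange`, `isOpen_setOf_finrank_ker_baseChange_lt` — Mumford §5 Cor. 1
  in degree `0`; Görtz–Wedhorn II, Thm. 23.139 (2); EGA III 7.7.5) — over ANY commutative ring, no matrices
  or minors;
* §3 **cohomology and base change**: `ker d ≅ Q^∨` (`nonempty_kerEquiv_dual_quotient`); if `Q` is PROJECTIVE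
  then `ker d` is finite projective and `B ⊗_A ker d ≅ ker(d ⊗_A B)` for EVERY `A`-algebra `B`
  (`nonempty_baseChange_kerEquiv_of_projective`, Mumford §5 Cor. 2 «⇐», EGA III 7.8.4 (d) ⇒ (a) — valid over
  non-reduced bases); and over a noetherian DOMAIN constancy of `h⁰` forces `Q` projective
  (`projective_quotient_dual_of_finrank_ker_baseChange_eq`), whence the printed Cor. 2 in degree `0`:
  **`nonempty_baseChange_kerEquiv_of_finrank_ker_baseChange_eq`** — «if `y ↦ dim H⁰(X_y, L_y)` is constant
  on an integral base then `π_*L` is locally free and commutes with arbitrary base change»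
  (Hartshorne III, Cor. 12.9 / Prop. 12.11 in degree `0`).

Design: no definitions (`Q` is spelled out as `Module.Dual A K0 ⧸ LinearMap.range d.dualMap` in every
statement); isomorphisms are asserted as `Nonempty (_ ≃ₗ[_] _)` / `∃ e, …` with the defining formula where a
consumer needs it (`nonempty_kerEquiv_ker_baseChange_self`). NOT here (sequel, geometric): the transport
through ★ `Modules.kernelReprEquiv(_natural)` to `y ↦ dim Γ(X_y, L_y)` on `P ×_K T` and the identification
of the base-change map with the canonical `b ⊗ s ↦ b · (1 ⊗ s)`; the reduced (non-integral) base case of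
Cor. 2. Neighbours in the Cartier-divisor / integral-total-space currency, NOT duplicated:
`Motives/SemicontinuityGrothendieckComplex`, `Motives/SeesawSemicontinuityKernelRank` (matrices of sections
over a scheme, rank via minors), `Motives/GrothendieckComplexH0Projective`. Mathlib searched and used (pin):
`Module.support`, `Module.isClosed_support`, `IsLocalRing.subsingleton_tensorProduct` (Nakayama),
`LocalizedModule.equivTensorProduct`, `TensorProduct.AlgebraTensorModule.cancelBaseChange`, `lTensor_exact`,
`exists_linearIndependent'`, `finrank_range_le_card`, `LinearMap.liftBaseChangeEquiv`,
`Subspace.dual_finrank_eq`, `LinearEquiv.congrLeft`, `Module.evalEquiv`, `Module.projective_of_localization_maximal`,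
`IsFractionRing.isFractionRing_of_isDomain_of_isLocalization`; Mathlib has `Module.rankAtStalk` /
`isLocallyConstant_rankAtStalk` only for flat (locally free) modules and no semicontinuity of fibre ranks.
Cell `hodgecm-mathlib`, SOCKETS-F §3 node N-bc (B-plan1 (g13)), count-neutral capital; B-p10 (g9).

## References

* D. Mumford, *Abelian Varieties*, TIFR Studies in Mathematics 5 (1970), §5: the Theorem (p. 46), Lemma 1
  (p. 47), Cor. 1 and Cor. 2 (p. 50). [MumfordAV1970]
* R. Hartshorne, *Algebraic Geometry*, GTM 52 (1977), II Ex. 5.8; III Prop. 12.4, Cor. 12.9, Prop. 12.11.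
  [Hartshorne1977]
* U. Görtz, T. Wedhorn, *Algebraic Geometry I: Schemes*, 2nd ed. (2020), Cor. 7.31. [GortzWedhorn2020]
* U. Görtz, T. Wedhorn, *Algebraic Geometry II: Cohomology of Schemes* (2023), Thm. 23.139 (2). [GortzWedhorn2023]
* H. Matsumura, *Commutative Ring Theory* (1986), Thm. 2.3 (Nakayama) and §7. [Matsumura1987]
* A. Grothendieck, EGA III₂ (1963), 7.7.5, 7.8.4.
-/

universe u

open TensorProduct Module

noncomputable section

namespace Literature.Algebra.Module

/-! ### §2 The two-term complex: `h⁰` as a fibre rank, and its upper semicontinuity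
(Mumford, *Abelian Varieties*, §5 Cor. 1–2; Görtz–Wedhorn II, Thm. 23.139 (2)) -/

section TwoTerm

open Literature.Algebra.Module.ReprModuleTwoTermKernel

variable {A : Type u} [CommRing A]
  {K0 K1 : Type u} [AddCommGroup K0] [Module A K0] [AddCommGroup K1] [Module A K1]
  [Module.Finite A K0] [Projective A K0] [Module.Finite A K1] [Projective A K1]

/-- **The kernel functor of `d : K⁰ → K¹` is represented by the EXPLICIT module
`Q = (K⁰)^∨ ⧸ im(d^∨)`**, naturally in the `A`-algebra: `η_B : Hom_A(Q, B) ≃ₗ[B] ker(d ⊗ B)` with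
`η_C(φ ∘ ℓ) = (φ ⊗ 1)(η_B ℓ)` — the statement of ★ `exists_reprModule_of_perfect_two_term` with its
witness named (same proof). [cite: MumfordAV1970, §5 Cor. 2 (p. 50)] -/
theorem exists_kerEquiv_quotient_dual (d : K0 →ₗ[A] K1) :
    ∃ η : ∀ (B : Type u) [CommRing B] [Algebra A B],
        ((Dual A K0 ⧸ LinearMap.range d.dualMap) →ₗ[A] B) ≃ₗ[B] LinearMap.ker (d.baseChange B),
      ∀ (B C : Type u) [CommRing B] [Algebra A B] [CommRing C] [Algebra A C] (φ : B →ₐ[A] C)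
        (ℓ : (Dual A K0 ⧸ LinearMap.range d.dualMap) →ₗ[A] B),
        ((η C ((φ.toLinearMap.restrictScalars A).comp ℓ) : C ⊗[A] K0)) =
          φ.toLinearMap.rTensor K0 ((η B ℓ) : B ⊗[A] K0) := by
  have hθ := fun (B : Type u) [CommRing B] [Algebra A B] => exists_dualHomEquiv A K0 B
  have hθ' := fun (B : Type u) [CommRing B] [Algebra A B] => exists_dualHomEquiv A K1 B
  choose θ hθ using hθ
  choose θ' hθ' using hθ'
  have hη := fun (B : Type u) [CommRing B] [Algebra A B] =>
    exists_kerEquiv_of_dualHom d B (θ B) (hθ B) (θ' B) (hθ' B)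
  choose η hη using hη
  refine ⟨fun B _ _ => η B, fun B C _ _ _ _ φ ℓ => ?_⟩
  rw [hη, hη]
  apply (θ C).injective
  rw [LinearEquiv.apply_symm_apply, dualHom_rTensor (θ B) (hθ B) (θ C) (hθ C) φ,
    LinearEquiv.apply_symm_apply, LinearMap.comp_assoc]

/-- **`h⁰` is a fibre rank**: for every `A`-algebra `κ` which is a field,
`dim_κ ker(d ⊗ κ) = dim_κ (κ ⊗_A Q)` with `Q = (K⁰)^∨ ⧸ im(d^∨)` (`η_κ` and the hom–tensor adjunction
`Hom_A(Q, κ) = (κ ⊗_A Q)^*`). [cite: MumfordAV1970, §5 Cor. 2 (p. 50)] -/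
theorem finrank_ker_baseChange_eq_finrank_tensor (d : K0 →ₗ[A] K1) (κ : Type u) [Field κ] [Algebra A κ] :
    finrank κ (LinearMap.ker (d.baseChange κ)) =
      finrank κ (κ ⊗[A] (Dual A K0 ⧸ LinearMap.range d.dualMap)) := by
  obtain ⟨η, -⟩ := exists_kerEquiv_quotient_dual d
  rw [← (η κ).finrank_eq,
    (LinearMap.liftBaseChangeEquiv κ :
      ((Dual A K0 ⧸ LinearMap.range d.dualMap) →ₗ[A] κ) ≃ₗ[κ]
        (κ ⊗[A] (Dual A K0 ⧸ LinearMap.range d.dualMap) →ₗ[κ] κ)).finrank_eq]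
  exact Subspace.dual_finrank_eq

/-- **Upper semicontinuity of `h⁰`** (Mumford, *Abelian Varieties*, §5 Cor. 1 (a) in degree `0`;
Görtz–Wedhorn II, Thm. 23.139 (2); EGA III 7.7.5): for a two-term complex `d : K⁰ → K¹` of finite
projective modules over ANY commutative ring `A` and every `n`, the set of primes `𝔭` with
`n ≤ dim_{κ(𝔭)} ker(d ⊗ κ(𝔭))` is CLOSED in `Spec A`. [cite: MumfordAV1970, §5 Cor. 1 (p. 50)]
[cite: GortzWedhorn2023, Thm. 23.139 (2)] -/
theorem isClosed_setOf_le_finrank_ker_baseChange (d : K0 →ₗ[A] K1) (n : ℕ) :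
    IsClosed {p : PrimeSpectrum A |
      n ≤ finrank p.asIdeal.ResidueField (LinearMap.ker (d.baseChange p.asIdeal.ResidueField))} := by
  have h : {p : PrimeSpectrum A |
      n ≤ finrank p.asIdeal.ResidueField (LinearMap.ker (d.baseChange p.asIdeal.ResidueField))} =
      {p | n ≤ finrank p.asIdeal.ResidueField
        (p.asIdeal.ResidueField ⊗[A] (Dual A K0 ⧸ LinearMap.range d.dualMap))} := by
    ext p; rw [Set.mem_setOf_eq, Set.mem_setOf_eq, finrank_ker_baseChange_eq_finrank_tensor]
  rw [h]
  exact isClosed_setOf_le_finrank_residueField_tensor _ n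

/-- The open form: `{𝔭 ; dim ker(d ⊗ κ(𝔭)) < n}` is open. [cite: MumfordAV1970, §5 Cor. 1 (p. 50)] -/
theorem isOpen_setOf_finrank_ker_baseChange_lt (d : K0 →ₗ[A] K1) (n : ℕ) :
    IsOpen {p : PrimeSpectrum A |
      finrank p.asIdeal.ResidueField (LinearMap.ker (d.baseChange p.asIdeal.ResidueField)) < n} := by
  have h : {p : PrimeSpectrum A |
      finrank p.asIdeal.ResidueField (LinearMap.ker (d.baseChange p.asIdeal.ResidueField)) < n} =
      {p | finrank p.asIdeal.ResidueField
        (p.asIdeal.ResidueField ⊗[A] (Dual A K0 ⧸ LinearMap.range d.dualMap)) < n} := by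
    ext p; rw [Set.mem_setOf_eq, Set.mem_setOf_eq, finrank_ker_baseChange_eq_finrank_tensor]
  rw [h]
  exact isOpen_setOf_finrank_residueField_tensor_lt _ n

end TwoTerm

/-! ### §3 Cohomology and base change from projectivity of `Q`
(Mumford, *Abelian Varieties*, §5 Cor. 2; EGA III 7.8.4; Hartshorne III, Prop. 12.9/12.11 in degree `0`) -/

section BaseChange

open Literature.Algebra.Module.ReprModuleTwoTermKernel

variable {A : Type u} [CommRing A]
  {K0 K1 : Type u} [AddCommGroup K0] [Module A K0] [AddCommGroup K1] [Module A K1]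
  [Module.Finite A K0] [Projective A K0] [Module.Finite A K1] [Projective A K1]

omit [Module.Finite A K0] [Projective A K0] [Module.Finite A K1] [Projective A K1] in
/-- `ker d ≃ₗ[A] ker(d ⊗_A A)` along `x ↦ 1 ⊗ x` (the unit isomorphism `A ⊗_A K⁰ ≅ K⁰` restricted to
kernels). [folklore] [cite: MumfordAV1970, §5 Cor. 2 (p. 50)] -/
theorem nonempty_kerEquiv_ker_baseChange_self (d : K0 →ₗ[A] K1) :
    ∃ e : LinearMap.ker d ≃ₗ[A] LinearMap.ker (d.baseChange A),
      ∀ x, ((e x : LinearMap.ker (d.baseChange A)) : A ⊗[A] K0) = (1 : A) ⊗ₜ[A] (x : K0) := by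
  have hnat : ∀ y : A ⊗[A] K0,
      d (TensorProduct.lid A K0 y) = TensorProduct.lid A K1 (d.baseChange A y) := by
    intro y
    induction y using TensorProduct.induction_on with
    | zero => simp
    | tmul a x => rw [TensorProduct.lid_tmul, LinearMap.baseChange_tmul, TensorProduct.lid_tmul, map_smul]
    | add y z hy hz => rw [map_add, map_add, hy, hz, map_add, map_add]
  refine ⟨LinearEquiv.ofLinear
      (LinearMap.codRestrict _ ((TensorProduct.mk A A K0 1).comp (LinearMap.ker d).subtype) fun x => ?_)
      (LinearMap.codRestrict _ ((TensorProduct.lid A K0).toLinearMap.comp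
        (LinearMap.ker (d.baseChange A)).subtype) fun y => ?_) ?_ ?_, fun x => rfl⟩
  · rw [LinearMap.mem_ker, LinearMap.comp_apply, Submodule.subtype_apply, TensorProduct.mk_apply,
      LinearMap.baseChange_tmul, (LinearMap.mem_ker.1 x.2), tmul_zero]
  · rw [LinearMap.mem_ker, LinearMap.comp_apply, Submodule.subtype_apply, LinearEquiv.coe_coe, hnat,
      (LinearMap.mem_ker.1 y.2), map_zero]
  · apply LinearMap.ext
    intro y
    apply Subtype.ext
    change (1 : A) ⊗ₜ[A] (TensorProduct.lid A K0 (y : A ⊗[A] K0)) = (y : A ⊗[A] K0)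
    rw [← TensorProduct.lid_symm_apply, LinearEquiv.symm_apply_apply]
  · apply LinearMap.ext
    intro x
    apply Subtype.ext
    change TensorProduct.lid A K0 ((1 : A) ⊗ₜ[A] (x : K0)) = (x : K0)
    rw [TensorProduct.lid_tmul, one_smul]

/-- **`ker d ≅ Hom_A(Q, A) = Q^∨`** for `Q = (K⁰)^∨ ⧸ im(d^∨)` (Mumford: the kernel functor is `Hom(Q, −)`,
evaluated at `B = A`). [cite: MumfordAV1970, §5 Cor. 2 (p. 50)] -/
theorem nonempty_kerEquiv_dual_quotient (d : K0 →ₗ[A] K1) :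
    Nonempty (LinearMap.ker d ≃ₗ[A] Dual A (Dual A K0 ⧸ LinearMap.range d.dualMap)) := by
  obtain ⟨η, -⟩ := exists_kerEquiv_quotient_dual d
  obtain ⟨e, -⟩ := nonempty_kerEquiv_ker_baseChange_self d
  exact ⟨e ≪≫ₗ (η A).symm⟩

/-- **Cohomology and base change in degree `0` from projectivity of `Q`** (Mumford, *Abelian Varieties*,
§5 Cor. 2, «⇐»; EGA III 7.8.4 (d) ⇒ (a); Hartshorne III, Prop. 12.11 (b) in degree `0`): if the finite
module `Q = (K⁰)^∨ ⧸ im(d^∨)` representing the kernel functor is PROJECTIVE, then for EVERY `A`-algebra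
`B` (no reducedness, no flatness) there is a `B`-linear isomorphism `B ⊗_A ker d ≅ ker(d ⊗_A B)`:
`B ⊗ Q^∨ ≅ Hom_A(Q^∨∨, B) ≅ Hom_A(Q, B) ≅ ker(d ⊗ B)` (projective duality ★ `exists_dualHomEquiv`,
reflexivity, `η_B`). [cite: MumfordAV1970, §5 Cor. 2 (p. 50)] [cite: Hartshorne1977, III Prop. 12.11] -/
theorem nonempty_baseChange_kerEquiv_of_projective (d : K0 →ₗ[A] K1)
    [Projective A (Dual A K0 ⧸ LinearMap.range d.dualMap)]
    (B : Type u) [CommRing B] [Algebra A B] :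
    Nonempty (B ⊗[A] LinearMap.ker d ≃ₗ[B] LinearMap.ker (d.baseChange B)) := by
  obtain ⟨η, -⟩ := exists_kerEquiv_quotient_dual d
  obtain ⟨e⟩ := nonempty_kerEquiv_dual_quotient d
  obtain ⟨θ, -⟩ := exists_dualHomEquiv A (Dual A (Dual A K0 ⧸ LinearMap.range d.dualMap)) B
  exact ⟨e.baseChange A B _ _ ≪≫ₗ θ ≪≫ₗ
    LinearEquiv.congrLeft (R := A) (S := B) (M := B)
      (evalEquiv A (Dual A K0 ⧸ LinearMap.range d.dualMap)).symm ≪≫ₗ η B⟩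

/-- `ker d` is finite projective whenever `Q = (K⁰)^∨ ⧸ im(d^∨)` is (it is `Q^∨`).
[cite: MumfordAV1970, §5 Cor. 2 (p. 50)] -/
theorem finite_projective_ker_of_projective (d : K0 →ₗ[A] K1)
    [Projective A (Dual A K0 ⧸ LinearMap.range d.dualMap)] :
    Module.Finite A (LinearMap.ker d) ∧ Projective A (LinearMap.ker d) := by
  obtain ⟨e⟩ := nonempty_kerEquiv_dual_quotient d
  exact ⟨Module.Finite.equiv e.symm, Projective.of_equiv e.symm⟩

/-- **Mumford, *Abelian Varieties*, §5 Cor. 2 in degree `0` (cohomology and base change for a two-term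
complex of finite projectives over an integral noetherian base):** if `𝔭 ↦ dim_{κ(𝔭)} ker(d ⊗ κ(𝔭))`
is CONSTANT on `Spec A`, `A` a noetherian domain, then the representing module `Q` is projective …
[cite: MumfordAV1970, §5 Cor. 2 (p. 50)] [cite: Hartshorne1977, III Cor. 12.9] -/
theorem projective_quotient_dual_of_finrank_ker_baseChange_eq [IsDomain A] [IsNoetherianRing A]
    (d : K0 →ₗ[A] K1) (r : ℕ) (h : ∀ p : PrimeSpectrum A,
      finrank p.asIdeal.ResidueField (LinearMap.ker (d.baseChange p.asIdeal.ResidueField)) = r) :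
    Projective A (Dual A K0 ⧸ LinearMap.range d.dualMap) :=
  projective_of_finrank_residueField_tensor_eq _ r fun p =>
    (finrank_ker_baseChange_eq_finrank_tensor d _).symm.trans (h p)

/-- **… hence `ker d` is finite projective of rank `r` and `B ⊗_A ker d ≅ ker(d ⊗_A B)` for EVERY
`A`-algebra `B`** («`π_* L` is locally free and its formation commutes with arbitrary base change»,
Mumford §5 Cor. 2; Hartshorne III, Cor. 12.9 with Prop. 12.11; EGA III 7.8.4).
[cite: MumfordAV1970, §5 Cor. 2 (p. 50)] [cite: Hartshorne1977, III Cor. 12.9] -/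
theorem nonempty_baseChange_kerEquiv_of_finrank_ker_baseChange_eq [IsDomain A] [IsNoetherianRing A]
    (d : K0 →ₗ[A] K1) (r : ℕ) (h : ∀ p : PrimeSpectrum A,
      finrank p.asIdeal.ResidueField (LinearMap.ker (d.baseChange p.asIdeal.ResidueField)) = r)
    (B : Type u) [CommRing B] [Algebra A B] :
    (Module.Finite A (LinearMap.ker d) ∧ Projective A (LinearMap.ker d)) ∧
      Nonempty (B ⊗[A] LinearMap.ker d ≃ₗ[B] LinearMap.ker (d.baseChange B)) := by
  haveI := projective_quotient_dual_of_finrank_ker_baseChange_eq d r h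
  exact ⟨finite_projective_ker_of_projective d, nonempty_baseChange_kerEquiv_of_projective d B⟩

end BaseChange

end Literature.Algebra.Module

end
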